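import Mathlib.Algebra.BigOperators.Fin
import Mathlib.Algebra.BigOperators.Pi
import Mathlib.Data.ZMod.Basic
import Mathlib.Data.Matrix.Mul
import Mathlib.LinearAlgebra.Dimension.Constructions
import Mathlib.Tactic.FinCases
import Mathlib.Tactic.Ring

/-!
# Tetradecic atlas, type `ℤ/14`: the cyclic CM fields of degree 14 — the Hodge lattice of the whole `F`-slice, nine rank-four faces as atoms, and the minimality `μ ≥ 9` (kernel census)

COR-CM (cell `pub-hodgecm2`), count-neutral kernel census by the PORTFOLIO seat lit-andre-3 (gen 13, own-lane ask A6-R34 "the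
tetradecic atlas"): the degree-14 rung of the cell's atlas by Galois type (degrees 6, 8, 10, 12: `Census/CyclicSexticSpecies`,
`Census/Octic*Species`, `Census/DecicCyclicSpecies`, `Census/Dodecic*Species` + `*Lattice`).  A group of order `14` with a central
involution is cyclic (`D₇` has trivial centre), so `(G, c) = (ℤ/14, 7)` is the WHOLE degree-14 rung: `F` = any cyclic CM field of degree
`14` (the degree-14 subfield of `ℚ(ζ₄₃)` or of `ℚ(ζ₄₉)`; `k·L` with `L` cyclic totally real of degree `7` and `k` imaginary quadratic).  Format,
statements and proofs follow the `ℤ/12` row (`Census/DodecicCyclicSpecies.lean`, b17): the Hodge lattice is a `Submodule ℤ (Pt → ℤ)`, the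
minimality is a theorem over ALL finite generating families, the lattice theorem (sequel `Census/TetradecicCyclicLattice.lean`) is an
equality of submodules.  No named fact, no geometry, no `sorry`: `decide`, `simp`, `omega`, linear algebra over `ZMod 2`.  HC_CM is not
proved anywhere in this cell; nothing here is a headline.  Cell note (face census, the `ℤ/2p` law, the empty Markman column, readings):
`HOME/pub-hodgecm2-lit-andre-3/PORTFOLIO-lit-andre-3-g13.md`; the sequel's docstring carries the summary.

DICTIONARY (cited, not formalised; identical to the octic/decic/dodecic files).  `F` Galois CM, `G = Gal(F/ℚ) = Hom(F, ℚ̄)`, `c ∈ Z(G)`;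
a CM type is `T ⊆ G` with `T ⊔ cT = G` (`cmTypes`); simple CM abelian varieties SPLIT BY `F` ↔ translation orbits of CM types, stabiliser
`H_T` ↔ CM field `K = F^{H_T}`, `dim = |G|/2|H_T|`, eigen-labels of `H¹` = `G/H_T = Hom(K, ℚ̄)` [cite: Milne1999, Prop. 2.1 and the
paragraph after it, p. 54]; a monomial with exponent vector `m ≥ 0` on a product of powers is a Hodge class iff all Pohlmann forms vanish
[cite: Pohlmann1968, Thm 1]; conjugate pairs = divisor classes.

THIS TYPE.  `G = ℤ/14`, `c = 7`; subgroups avoiding `c`: `0` and `⟨2⟩`, so the CM subfields of `F` are `F` and the imaginary quadratic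
`k = F^⟨2⟩` — none of degree `4, …, 12`.  `types_census*`: `128 = 2 + 9·14` CM types — the CM elliptic curve `E` of `k` (`eType`, stabiliser
`⟨2⟩`) and nine pairwise non-isogenous simple CM SEVENFOLDS `B₀, …, B₈` (`blockType`, trivial stabilisers).  `aut_species`: under `Aut(G) ≅
ℤ/6` the classes form the species `{B₀,B₄,B₈}`, `{B₁,B₅,B₇}`, `{B₂,B₃}`, `{B₆}`; the INVERSE TYPE `−T` (b26's census) stays in the class except
`B₂ ↔ B₃`.  `signature_census`: `k`-signatures `(#even, #odd)` = `(4,3),(5,2),(4,3),(3,4),(4,3),(5,2),(6,1),(5,2),(3,4)`, `s_b = #even − #odd`.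
LABELS (`Pt`, `128`): `e u` (`u ∈ ℤ/2 = Hom(k, ℚ̄)`), `q b t` (`t ∈ ℤ/14`); `act` = translation; `phi` = total type (`labels_census`).
NUMBERS (exact oracles; re-decided by the sequel's certificate): forms of rank `7`, `H ⊂ ℤ^{128}` of rank `121`, `64` pairs, `H/P ≅ ℤ^{57}`
(`≅ ker(ℤ ⊕ ℤ[ℤ/7]⁹ → ℤ[ℤ/7])`, `(H/P) ⊗ ℚ ≅ ℚ⁹ ⊕ ℚ(ζ₇)⁸`); every factor nondegenerate (b04's
`Summit.HodgeConjecture.CorCM.CyclicTwoPower.isNondegenerate_of_isPrimitive_of_isCyclic`: HC on all powers `E^a`, `B_bⁿ` unconditionally);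
no exceptional class on carriers of dimension `≤ 7`; the smallest exceptional carriers are the five EIGHTFOLDS `E × B_b`, `|s_b| = 1`, each
carrying exactly the Weil plane of `k` (`weilVec`); of the `688` translation orbits of exceptional degree-4 monomials exactly `48` (`672`
classes, orbits of size `14`) are TYPE SQUARES = the rank-four faces of b30's `Census/FaceSquaresModel.lean` (the decidable test
`typeSquareTest`; calibrated on `ℤ/10` against `Census/DecicFaceSquaresCyclic.lean`: `80` squares, `8` orbits, `22` minimal triples, exactly).

THE NINE ATOMS (`orbitRep`, `atoms_typeSquare`, `atom_census`): nine type squares whose translates generate `H` with the pairs (sequel):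
`R₀` on `E × B₆ × B₇` (the face through `E` and the sevenfold of `k`-signature `(6,1)`), `R₁ = ⋀³ ⊗ 1` on the `14`-fold `B₀ × B₅`, `R₂` on
`B₀ × B₃ × B₅`, `R₅` on `B₀ × B₅ × B₆`, and `R₃, R₄, R₆, R₇, R₈` with one label on each of four sevenfolds (`B₀B₂B₅B₈`, `B₀B₂B₃B₅`, `B₀B₁B₅B₆`,
`B₂B₃B₄B₅`, `B₃B₅B₆B₇`).  MINIMALITY `μ(ℤ/14) ≥ 9` (`nine_le_card_of_generates`): the nine block parities are `ℤ`-linear, translation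
invariant, zero on pairs and ONTO `𝔽₂⁹` on `H`, the unit vectors being the parities of the WEIL VECTORS `weilVec b` (the Weil class of `k`
on the Weil-type `(7+|s_b|)`-fold `E^{|s_b|} × B_b`; `weilVec_hodge`, `weil_census`).  The same parity argument gives, for every odd prime
`p`, `μ(ℤ/2p) ≥ (2^{p−1} − 1)/p` = the number of simple CM `p`-fold classes (`1, 3, 9, 93, 315` for `2p = 6, 10, 14, 22, 26`), with equality
at `6, 10, 14` by the cell's lattice theorems.

## References
* [Pohlmann1968] H. Pohlmann, Algebraic cycles on abelian varieties of complex multiplication type, Ann. of Math. 88 (1968), Thm 1.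
* [Milne1999] J. S. Milne, Lefschetz motives and the Tate conjecture, Compositio Math. 117 (1999), Prop. 2.1, p. 54.

## Provenance
Exact oracles (seat folder `scratch/`, copies `HOME/pub-hodgecm2-lit-andre-3/g13/`): `tetra0.py`, `dspace.py`, `tetra2.py`–`tetra7.py`,
`gen_tetra.py` (the `ℤ^{128}` model with this file's conventions, cross-checked against `closure_slice.py`; emits both files' tables).
-/
namespace Summit.HodgeConjecture.CorCM.Census.TetradecicCyclicSpecies

open Finset

/-! ## The group `ℤ/14`, its CM types and the simple factors -/
/-- The CM types of `(ℤ/14, 7)` as subsets `T ⊆ ℤ/14`: for every `g` exactly one of `g`, `7 + g` lies in `T`. [folklore] -/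
def cmTypes : Finset (Finset (ZMod 14)) := univ.powerset.filter fun T => ∀ g : ZMod 14, g ∈ T ↔ 7 + g ∉ T

/-- The type of the CM elliptic curve `E`: `⟨2⟩ ⊂ ℤ/14`, induced from `k = F^⟨2⟩`. [folklore] -/
def eType : Finset (ZMod 14) := {0, 2, 4, 6, 8, 10, 12}

/-- The nine primitive CM types (one representative per translation orbit): the simple CM sevenfolds `B₀, …, B₈`. [folklore] -/
def blockType : Fin 9 → Finset (ZMod 14) :=
  ![{0, 1, 2, 10, 11, 12, 13},
    {0, 1, 2, 6, 10, 11, 12},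
    {0, 1, 6, 9, 10, 11, 12},
    {0, 1, 2, 5, 10, 11, 13},
    {0, 1, 2, 5, 6, 10, 11},
    {0, 1, 2, 4, 10, 12, 13},
    {0, 1, 2, 4, 6, 10, 12},
    {0, 1, 4, 6, 9, 10, 12},
    {0, 1, 3, 6, 9, 11, 12}]

set_option maxRecDepth 20000 in
set_option maxHeartbeats 800000 in
/-- **Types census (count).**  `(ℤ/14, 7)` has exactly `2⁷ = 128` CM types. [folklore] -/
theorem types_census_card : cmTypes.card = 128 := by
  decide +kernel

set_option maxRecDepth 20000 in
set_option maxHeartbeats 800000 in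
/-- **Types census (classification).**  The CM types are exactly the translates of `eType` and of the nine block types. [folklore] -/
theorem types_census_eq : cmTypes = (univ.image fun g : ZMod 14 => eType.image (fun t => t + g)) ∪
      (univ ×ˢ (univ : Finset (Fin 9))).image (fun p => (blockType p.2).image (fun t => t + p.1)) := by
  decide +kernel

set_option maxRecDepth 20000 in
set_option maxHeartbeats 800000 in
/-- **Types census (stabilisers and orbits).**  The stabilisers are `⟨2⟩` for `eType` and trivial for the block types; orbit sizes `2` and
`14, …, 14` (`2 + 9·14 = 128`, so with `types_census_card`/`types_census_eq` the ten orbits are pairwise disjoint: `E, B₀, …, B₈` are pairwise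
non-isogenous and exhaust the simple CM abelian varieties split by `F`; `dim E = 1`, `dim B_b = 7`). [folklore] -/
theorem types_census : (univ.filter fun g : ZMod 14 => eType.image (fun t => t + g) = eType) = {0, 2, 4, 6, 8, 10, 12} ∧
    (∀ b : Fin 9, (univ.filter fun g : ZMod 14 => (blockType b).image (fun t => t + g) = blockType b) = {0}) ∧
    (univ.image fun g : ZMod 14 => eType.image (fun t => t + g)).card = 2 ∧
    (∀ b : Fin 9, (univ.image fun g : ZMod 14 => (blockType b).image (fun t => t + g)).card = 14) := by
  refine ⟨by decide +kernel, by decide +kernel, by decide +kernel, by decide +kernel⟩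

/-- The permutation of the nine classes induced by the automorphism `t ↦ 3t` of `ℤ/14` (a generator of `Aut(ℤ/14) ≅ ℤ/6`). [folklore] -/
def autPerm : Fin 9 → Fin 9 := ![8, 5, 3, 2, 0, 7, 6, 1, 4]

/-- The class of the inverse type `−T(B_b)`: identity except `B₂ ↔ B₃`. [folklore] -/
def invPerm : Fin 9 → Fin 9 := ![0, 1, 3, 2, 4, 5, 6, 7, 8]

/-- **Species.**  `t ↦ 3t` fixes the class of `E` and permutes the sevenfold classes by `autPerm` (orbits `{0,4,8}`, `{1,5,7}`, `{2,3}`, `{6}`);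
the inverse type `−T` lies in the orbit of `T(B_{invPerm b})`: its own class except `B₂ ↔ B₃` (b26: always its own class only for `|G| ≤ 10`). [folklore] -/
theorem aut_species : eType.image (fun t => 3 * t) = eType ∧ eType.image (fun t => -t) = eType ∧
    (∀ b : Fin 9, (blockType b).image (fun t => 3 * t) ∈ univ.image (fun g : ZMod 14 => (blockType (autPerm b)).image (fun t => t + g))) ∧
    (∀ b : Fin 9, (blockType b).image (fun t => -t) ∈ univ.image (fun g : ZMod 14 => (blockType (invPerm b)).image (fun t => t + g))) ∧
    (∀ b : Fin 9, b ≠ 2 → b ≠ 3 → (blockType b).image (fun t => -t) ∈ univ.image (fun g : ZMod 14 => (blockType b).image (fun t => t + g))) ∧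
    (blockType 2).image (fun t => -t) ∉ univ.image (fun g : ZMod 14 => (blockType 2).image (fun t => t + g)) := by
  refine ⟨by decide +kernel, by decide +kernel, by decide +kernel, by decide +kernel, by decide +kernel, by decide +kernel⟩

/-- `s_b = #even − #odd` of the block types: the `k`-signature defect. [folklore] -/
def sB : Fin 9 → ℤ := ![1, 3, 1, -1, 1, 3, 5, 3, -1]

/-- **Signatures.**  The restriction of `t ∈ ℤ/14` to `k = F^⟨2⟩` is its parity: `k`-signature of `B_b` = `(#even, #odd of T(B_b))`, `s_b` as
tabulated, `eType` all even; so `E^{|s_b|} × B_b` (with `E` conjugated when `s_b > 0`) is of Weil type, smallest: the eightfolds `E × B_b`, `|s_b| = 1`. [folklore] -/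
theorem signature_census :
    (∀ b : Fin 9, (((blockType b).filter fun t => t.val % 2 = 0).card, ((blockType b).filter fun t => t.val % 2 = 1).card) =
      (![(4, 3), (5, 2), (4, 3), (3, 4), (4, 3), (5, 2), (6, 1), (5, 2), (3, 4)] : Fin 9 → ℕ × ℕ) b) ∧
    (∀ b : Fin 9, sB b = (((blockType b).filter fun t => t.val % 2 = 0).card : ℤ) - ((blockType b).filter fun t => t.val % 2 = 1).card) ∧
    (eType.filter fun t => t.val % 2 = 0) = eType := by
  refine ⟨by decide +kernel, by decide +kernel, by decide +kernel⟩

/-! ## Labels, the Galois action, the total type -/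
/-- Labels of the CM eigenvectors: `e u` (`u ∈ ℤ/2 = Hom(k, ℚ̄)`, the elliptic curve) and `q b t` (`t ∈ ℤ/14 = Hom(F, ℚ̄)`, the sevenfold
`B_b`); `128 = 2 + 9·14` labels. [folklore] -/
abbrev Pt := ZMod 2 ⊕ (Fin 9 × ZMod 14)

/-- `e u`: the eigen-label `u ∈ ℤ/2` of `E` (`u = 0`: the even coset, of Hodge type `(1,0)`). [folklore] -/
abbrev e (u : ZMod 2) : Pt := Sum.inl u

/-- `q b t`: the eigen-label `t ∈ ℤ/14` of the sevenfold `B_b`. [folklore] -/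
abbrev q (b : Fin 9) (t : ZMod 14) : Pt := Sum.inr (b, t)

/-- The quotient map `ℤ/14 → ℤ/2 = G/⟨2⟩` (parity): the restriction of the embedding `t` to `k`. [folklore] -/
def eps (g : ZMod 14) : ZMod 2 := (g.val : ZMod 2)

/-- `G = ℤ/14` acts on the labels by translation (Galois conjugation of eigenvectors). [folklore] -/
def act (g : ZMod 14) : Pt → Pt
  | Sum.inl u => Sum.inl (eps g + u)
  | Sum.inr (b, t) => Sum.inr (b, g + t)

/-- The total CM type `Φ` (the `64` labels of Hodge type `(1,0)`), block by block (`labels_census`). [folklore] -/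
def phi : Finset Pt := {e 0, q 0 0, q 0 1, q 0 2, q 0 10, q 0 11, q 0 12, q 0 13, q 1 0, q 1 1, q 1 2, q 1 6, q 1 10, q 1 11, q 1 12, q 2 0,
  q 2 1, q 2 6, q 2 9, q 2 10, q 2 11, q 2 12, q 3 0, q 3 1, q 3 2, q 3 5, q 3 10, q 3 11, q 3 13, q 4 0, q 4 1, q 4 2, q 4 5, q 4 6, q 4 10,
  q 4 11, q 5 0, q 5 1, q 5 2, q 5 4, q 5 10, q 5 12, q 5 13, q 6 0, q 6 1, q 6 2, q 6 4, q 6 6, q 6 10, q 6 12, q 7 0, q 7 1, q 7 4, q 7 6,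
  q 7 9, q 7 10, q 7 12, q 8 0, q 8 1, q 8 3, q 8 6, q 8 9, q 8 11, q 8 12}

set_option maxRecDepth 20000 in
/-- `Φ` is a CM type for `c = 7`, and `act` is an action (closed sanity check). [folklore] -/
theorem sanity : (∀ x : Pt, x ∈ phi ↔ act 7 x ∉ phi) ∧ (∀ g h : ZMod 14, ∀ x : Pt, act (g + h) x = act g (act h x)) ∧
    (∀ x : Pt, act 0 x = x) := by
  refine ⟨by decide +kernel, by decide +kernel, by decide +kernel⟩

set_option maxRecDepth 20000 in
/-- **Labels census**: `eps` is a homomorphism onto `ℤ/2` with kernel `⟨2⟩`, and `Φ` is the total type induced by the block types: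
`e (eps g) ∈ Φ ↔ g ∈ eType`, `q b g ∈ Φ ↔ g ∈ blockType b`; `Φ` has `64` of the `128` labels. [folklore] -/
theorem labels_census : (∀ g h : ZMod 14, eps (g + h) = eps g + eps h) ∧
    (univ.filter fun g : ZMod 14 => eps g = 0) = {0, 2, 4, 6, 8, 10, 12} ∧
    (∀ g : ZMod 14, e (eps g) ∈ phi ↔ g ∈ eType) ∧ (∀ b : Fin 9, ∀ g : ZMod 14, q b g ∈ phi ↔ g ∈ blockType b) ∧
    phi.card = 64 ∧ Fintype.card Pt = 128 := by
  refine ⟨by decide +kernel, by decide +kernel, by decide +kernel, by decide +kernel, by decide +kernel, by simp⟩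

/-! ## Pohlmann's Hodge forms and the Hodge lattice -/
/-- Pohlmann's Hodge functional of `g ∈ ℤ/14` on integer exponent vectors: `Σ_x (2[g·x ∈ Φ] − 1) m_x`. [cite: Pohlmann1968, Thm 1] -/
def hodgeForm (g : ZMod 14) (m : Pt → ℤ) : ℤ := ∑ x : Pt, (if act g x ∈ phi then m x else -m x)

/-- Block types as a Boolean table (labels `q b t`): entry `(b, t)` = `[t ∈ blockType b]` (kernel-fast). [folklore] -/
def tB : Fin 9 → Fin 14 → Bool :=
  ![![true, true, true, false, false, false, false, false, false, false, true, true, true, true],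
    ![true, true, true, false, false, false, true, false, false, false, true, true, true, false],
    ![true, true, false, false, false, false, true, false, false, true, true, true, true, false],
    ![true, true, true, false, false, true, false, false, false, false, true, true, false, true],
    ![true, true, true, false, false, true, true, false, false, false, true, true, false, false],
    ![true, true, true, false, true, false, false, false, false, false, true, false, true, true],
    ![true, true, true, false, true, false, true, false, false, false, true, false, true, false],
    ![true, true, false, false, true, false, true, false, false, true, true, false, true, false],
    ![true, true, false, true, false, false, true, false, false, true, false, true, true, false]]

/-- Boolean membership in `Φ` (kernel-fast twin of `· ∈ phi`, see `inPhi_iff`). [folklore] -/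
def inPhi : Pt → Bool
  | Sum.inl u => decide (u = 0)
  | Sum.inr (b, t) => tB b t

set_option maxRecDepth 20000 in
/-- `inPhi` decides membership in `Φ`. [folklore] -/
theorem inPhi_iff : ∀ x : Pt, inPhi x = true ↔ x ∈ phi := by decide +kernel

/-- The coefficient vector `(2[g·x ∈ Φ] − 1)_x ∈ {±1}^{128}` of Pohlmann's form `hodgeForm g`. [cite: Pohlmann1968, Thm 1] -/
def hodgeVec (g : ZMod 14) (x : Pt) : ℤ := if inPhi (act g x) then 1 else -1

/-- `hodgeVec` in terms of `Φ`. [folklore] -/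
theorem hodgeVec_apply (g : ZMod 14) (x : Pt) : hodgeVec g x = if act g x ∈ phi then 1 else -1 := by
  unfold hodgeVec
  by_cases h : act g x ∈ phi
  · simp [h, (inPhi_iff (act g x)).mpr h]
  · have h' : inPhi (act g x) ≠ true := fun h'' => h ((inPhi_iff _).mp h'')
    simp [h, h']

/-- Pohlmann's form is the dot product with its coefficient vector. [folklore] -/
theorem hodgeForm_eq (g : ZMod 14) (m : Pt → ℤ) : hodgeForm g m = hodgeVec g ⬝ᵥ m := by
  unfold hodgeForm dotProduct
  refine Finset.sum_congr rfl fun x _ => ?_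
  rw [hodgeVec_apply]
  by_cases hx : act g x ∈ phi <;> simp [hx]

/-- **The Hodge lattice** `H ⊂ ℤ^{128}` of the whole `F`-slice (rank `121` by the oracle). [cite: Pohlmann1968, Thm 1] -/
def hodgeLattice : Submodule ℤ (Pt → ℤ) where
  carrier := {m | ∀ g : ZMod 14, hodgeVec g ⬝ᵥ m = 0}
  zero_mem' := by intro g; simp
  add_mem' := by
    intro m m' hm hm' g
    rw [dotProduct_add, hm g, hm' g, add_zero]
  smul_mem' := by
    intro c m hm g
    rw [dotProduct_smul, hm g, smul_zero]

/-- Membership in the Hodge lattice = vanishing of all Pohlmann forms. [folklore] -/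
theorem mem_hodgeLattice (m : Pt → ℤ) : m ∈ hodgeLattice ↔ ∀ g : ZMod 14, hodgeForm g m = 0 := by
  simp only [hodgeForm_eq]; rfl

/-- The conjugate pair through a label (a divisor-class monomial `e_x ∧ e_{cx}`). [folklore] -/
def pairVec (x : Pt) (y : Pt) : ℤ := if y = x ∨ y = act 7 x then 1 else 0

/-- The divisor sublattice `P = ℤ⟨64 conjugate pairs⟩`. [folklore] -/
def pairs : Submodule ℤ (Pt → ℤ) := Submodule.span ℤ (Set.range pairVec)

/-- Galois translate of an exponent vector: `(g·v)(y) = v(y − g)`. [folklore] -/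
def transl (g : ZMod 14) (v : Pt → ℤ) (y : Pt) : ℤ := v (act (-g) y)

/-! ## The nine atoms: type squares (rank-four faces) -/
/-- Representatives of the NINE atom orbits, each a TYPE SQUARE (four labels): `R₀` on `E × B₆ × B₇`, `R₁` on `B₀ × B₅` (`⋀³ ⊗ 1`), `R₂` on
`B₀ × B₃ × B₅`, `R₃` on `B₀B₂B₅B₈`, `R₄` on `B₀B₂B₃B₅`, `R₅` on `B₀ × B₅ × B₆`, `R₆` on `B₀B₁B₅B₆`, `R₇` on `B₂B₃B₄B₅`, `R₈` on `B₃B₅B₆B₇`. [folklore] -/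
def orbitRep : Fin 9 → Finset Pt :=
  ![{e 1, q 6 12, q 6 6, q 7 13},
    {q 0 7, q 0 1, q 0 9, q 5 2},
    {q 0 7, q 0 1, q 3 8, q 5 0},
    {q 0 7, q 2 13, q 5 0, q 8 6},
    {q 0 7, q 2 13, q 3 10, q 5 2},
    {q 0 7, q 5 0, q 5 2, q 6 9},
    {q 0 7, q 1 0, q 5 2, q 6 11},
    {q 2 7, q 3 12, q 4 5, q 5 4},
    {q 3 7, q 5 13, q 6 6, q 7 13}]

/-- The atom monomials as exponent vectors. [folklore] -/
def atomVec (k : Fin 9) (y : Pt) : ℤ := if y ∈ orbitRep k then 1 else 0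

/-- The atom sublattice `A = Σ_{k<9} ℤ[G]·atom_k` (all translates of the nine squares). [folklore] -/
def atoms : Submodule ℤ (Pt → ℤ) := Submodule.span ℤ (Set.range fun p : ZMod 14 × Fin 9 => transl p.1 (atomVec p.2))

/-- The block of a label: `0` for `E`, `b+1` for `B_b`. [folklore] -/
def blockOf : Pt → Fin 10
  | Sum.inl _ => 0
  | Sum.inr (b, _) => b.succ

/-- The CM type at a label: `Ψ_x = {g | g·x ∈ Φ}` (a translate of the block type: the type of the factor carrying `e_x` in `H^{1,0}`). [folklore] -/
def cornerType (x : Pt) : Finset (ZMod 14) := univ.filter fun g => act g x ∈ phi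

/-- Decidable test "the `4`-set `s` of labels is a TYPE SQUARE": four labels, SumTwo (for every `g` exactly two of the four corner types
contain `g` — the Hodge condition for the degree-4 monomial, rfwf Lemma 1.2), no conjugate pair inside (exceptional), and two corners whose
types differ at exactly two places (`4` group elements) — then the other two corners are forced to be `Φ̄^π, Φ̄^{π′}` (b30's squares). [folklore] -/
def typeSquareTest (s : Finset Pt) : Bool :=
  decide (s.card = 4 ∧ (∀ g : ZMod 14, (s.filter fun x => act g x ∈ phi).card = 2) ∧ (∀ x ∈ s, act 7 x ∉ s) ∧
    ∃ x ∈ s, ∃ y ∈ s, ((cornerType x \ cornerType y) ∪ (cornerType y \ cornerType x)).card = 4)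

set_option maxRecDepth 20000 in
/-- **Atom census**: labels per block (`E, B₀, …, B₈`; minimal carriers `E × B₆ × B₇` (dim 15), `B₀ × B₅` (14), three blocks (21), four
blocks (28)), all nine orbits have size `14`, and every atom is a type square; the corner types are CM types. [folklore] -/
theorem atom_census :
    (∀ k : Fin 9, (fun j : Fin 10 => ((orbitRep k).filter fun x => blockOf x = j).card) =
      (![![1, 0, 0, 0, 0, 0, 0, 2, 1, 0], ![0, 3, 0, 0, 0, 0, 1, 0, 0, 0], ![0, 2, 0, 0, 1, 0, 1, 0, 0, 0], ![0, 1, 0, 1, 0, 0, 1, 0, 0, 1],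
         ![0, 1, 0, 1, 1, 0, 1, 0, 0, 0], ![0, 1, 0, 0, 0, 0, 2, 1, 0, 0], ![0, 1, 1, 0, 0, 0, 1, 1, 0, 0], ![0, 0, 0, 1, 1, 1, 1, 0, 0, 0],
         ![0, 0, 0, 0, 1, 0, 1, 1, 1, 0]] : Fin 9 → Fin 10 → ℕ) k) ∧
    (∀ k : Fin 9, (univ.image fun g : ZMod 14 => (orbitRep k).image (act g)).card = 14) ∧
    (∀ k : Fin 9, ∀ x ∈ orbitRep k, cornerType x ∈ cmTypes) := by
  refine ⟨by decide +kernel, by decide +kernel, ?_⟩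
  intro k x _
  simp only [cmTypes, cornerType, mem_filter, mem_powerset, subset_univ, true_and, mem_univ]
  intro g
  have h := sanity.1 (act g x)
  rw [← sanity.2.1] at h
  exact h

set_option maxRecDepth 20000 in
/-- **The atoms are type squares** (rank-four faces of the face-period programme). [folklore] -/
theorem atoms_typeSquare : ∀ k : Fin 9, typeSquareTest (orbitRep k) = true := by
  decide +kernel

set_option maxRecDepth 20000 in
/-- Every conjugate pair is a Hodge vector. [folklore] -/
theorem pairVec_hodge : ∀ x : Pt, ∀ g : ZMod 14, hodgeVec g ⬝ᵥ pairVec x = 0 := by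
  decide +kernel

set_option maxRecDepth 20000 in
/-- Every translate of every atom is a Hodge vector. [folklore] -/
theorem atom_hodge : ∀ h g : ZMod 14, ∀ k : Fin 9, hodgeVec g ⬝ᵥ transl h (atomVec k) = 0 := by
  decide +kernel

/-- `P ≤ H`. [folklore] -/
theorem pairs_le : pairs ≤ hodgeLattice :=
  Submodule.span_le.mpr (by rintro _ ⟨x, rfl⟩ g; exact pairVec_hodge x g)

/-- `A ≤ H`. [folklore] -/
theorem atoms_le : atoms ≤ hodgeLattice :=
  Submodule.span_le.mpr (by rintro _ ⟨p, rfl⟩ g; exact atom_hodge p.1 g p.2)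

/-- Atoms are in `A`. [folklore] -/
theorem atomVec_mem (k : Fin 9) : atomVec k ∈ atoms := by
  have h : transl 0 (atomVec k) = atomVec k := by
    funext y; simp only [transl, neg_zero, sanity.2.2 y]
  exact h ▸ Submodule.subset_span ⟨(0, k), rfl⟩

/-! ## The Weil vectors and minimality: no eight Galois orbits generate (`μ(ℤ/14) ≥ 9`) -/
/-- The WEIL VECTOR of block `b`: `1` at the seven even labels of `B_b`, `|s_b|` at the complementary `E`-label — the top exterior power over
`k` of a `k`-eigenspace of `H¹(E^{|s_b|} × B_b)`, a Weil class of `k` on that Weil-type `(7+|s_b|)`-fold. [folklore] -/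
def weilVec (b : Fin 9) : Pt → ℤ
  | Sum.inl u => if 0 < sB b then (if u = 1 then sB b else 0) else (if u = 0 then -sB b else 0)
  | Sum.inr (b', t) => if b' = b ∧ t.val % 2 = 0 then 1 else 0

set_option maxRecDepth 20000 in
/-- The Weil vectors are Hodge vectors (exceptional classes in codimension `(7+|s_b|)/2 = 4, 5, 6` on `E^{|s_b|} × B_b`). [folklore] -/
theorem weilVec_hodge : ∀ b : Fin 9, ∀ g : ZMod 14, hodgeVec g ⬝ᵥ weilVec b = 0 := by
  decide +kernel

/-- The Weil vectors lie in `H`. [folklore] -/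
theorem weilVec_mem (b : Fin 9) : weilVec b ∈ hodgeLattice := fun g => weilVec_hodge b g

set_option maxRecDepth 20000 in
/-- **Weil census**: total degree `7 + |s_b| ∈ {8, 10, 8, 8, 8, 10, 12, 10, 8}` (twice the codimension; the carrier `E^{|s_b|} × B_b` has the
same dimension), and the Weil vector is not a sum of conjugate pairs (odd block degree). [folklore] -/
theorem weil_census : (∀ b : Fin 9, ∑ y : Pt, weilVec b y = (![8, 10, 8, 8, 8, 10, 12, 10, 8] : Fin 9 → ℤ) b) ∧
    (∀ b : Fin 9, (∑ t : ZMod 14, weilVec b (q b t)) % 2 = 1) := by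
  refine ⟨by decide +kernel, by decide +kernel⟩

/-- The nine `B`-block parities `m ↦ (Σ_t m(q b t) mod 2)_b`, a `ℤ`-linear map `ℤ^{128} → 𝔽₂⁹`. [folklore] -/
def parity : (Pt → ℤ) →ₗ[ℤ] (Fin 9 → ZMod 2) where
  toFun m := fun b => ∑ t : ZMod 14, ((m (q b t) : ℤ) : ZMod 2)
  map_add' m m' := by
    funext b
    simp only [Pi.add_apply, Int.cast_add, Finset.sum_add_distrib]
  map_smul' c m := by
    funext b
    simp only [Pi.smul_apply, smul_eq_mul, Int.cast_mul, RingHom.id_apply, ← Finset.mul_sum, zsmul_eq_mul]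

set_option maxRecDepth 20000 in
/-- The parities vanish on conjugate pairs. [folklore] -/
theorem parity_pairVec : ∀ x : Pt, parity (pairVec x) = 0 := by
  decide +kernel

/-- The parities are translation invariant. [folklore] -/
theorem parity_transl (g : ZMod 14) (v : Pt → ℤ) : parity (transl g v) = parity v := by
  funext b
  show ∑ h : ZMod 14, ((v (act (-g) (q b h)) : ℤ) : ZMod 2) = ∑ h : ZMod 14, ((v (q b h) : ℤ) : ZMod 2)
  exact Fintype.sum_equiv (Equiv.addLeft (-g)) _ _ (fun h => rfl)

set_option maxRecDepth 20000 in
/-- The Weil vectors realise the unit vectors of `𝔽₂⁹`: `parity` maps `H` onto `𝔽₂⁹`. [folklore] -/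
theorem parity_weilVec : ∀ b : Fin 9, parity (weilVec b) = Pi.single b 1 := by
  decide +kernel

/-- **MINIMALITY (`μ(ℤ/14) ≥ 9`).**  If the Hodge lattice is generated, together with the divisor classes, by the translates of a finite
family `S` of integer vectors, then `|S| ≥ 9` (the parity map is translation invariant, kills the pairs and maps `H` onto `𝔽₂⁹`). [folklore] -/
theorem nine_le_card_of_generates (S : Finset (Pt → ℤ))
    (hS : hodgeLattice ≤ pairs ⊔ Submodule.span ℤ {v | ∃ g : ZMod 14, ∃ t ∈ S, v = transl g t}) : 9 ≤ S.card := by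
  classical
  let T : Finset (Fin 9 → ZMod 2) := S.image parity
  let W : Submodule ℤ (Fin 9 → ZMod 2) := (Submodule.span (ZMod 2) (T : Set (Fin 9 → ZMod 2))).restrictScalars ℤ
  have hle : pairs ⊔ Submodule.span ℤ {v | ∃ g : ZMod 14, ∃ t ∈ S, v = transl g t} ≤ W.comap parity := by
    refine sup_le (Submodule.span_le.mpr ?_) (Submodule.span_le.mpr ?_)
    · rintro _ ⟨x, rfl⟩
      simp [W, parity_pairVec x]
    · rintro _ ⟨g, t, ht, rfl⟩
      have hmem : parity t ∈ (T : Set (Fin 9 → ZMod 2)) := by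
        simpa [T] using Finset.mem_image_of_mem parity ht
      simpa [W, parity_transl] using Submodule.subset_span hmem
  have hunit : ∀ b : Fin 9, (Pi.single b 1 : Fin 9 → ZMod 2) ∈ Submodule.span (ZMod 2) (T : Set (Fin 9 → ZMod 2)) := by
    intro b
    have h := hle (hS (weilVec_mem b))
    simpa [W, parity_weilVec b] using h
  have htop : Submodule.span (ZMod 2) (T : Set (Fin 9 → ZMod 2)) = ⊤ := by
    refine Submodule.eq_top_iff'.mpr fun w => ?_
    rw [pi_eq_sum_univ' w]
    exact Submodule.sum_mem _ fun b _ => Submodule.smul_mem _ _ (hunit b)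
  have h1 : Module.finrank (ZMod 2) (Submodule.span (ZMod 2) (T : Set (Fin 9 → ZMod 2))) ≤ T.card :=
    finrank_span_finset_le_card T
  rw [htop, finrank_top, Module.finrank_fin_fun] at h1
  exact h1.trans Finset.card_image_le

end Summit.HodgeConjecture.CorCM.Census.TetradecicCyclicSpecies
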